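import Mathlib.MeasureTheory.Function.L2Space
import Mathlib.Analysis.InnerProductSpace.GramSchmidtOrtho
import Mathlib.Data.Fintype.Pigeonhole
import Literature.NumberTheory.LFunctions.WeilSemilocalCompactnessProofs
import HarnessLib

/-!
# RiemannHypothesis / RuelleBand — every window has finite Weil index

Route `RiemannHypothesis/RuelleBand`, crux item stmt-RiemannHypothesis-2064
(`CofiniteCriticalLine`), line `cofinite-weil-index-staircase`, stub `stub_windowIndexFinite`
(helper file, `--supports`).

**Statement.** For every window `a : ℝ` there is `N : ℕ` such that no `(N+1)`-tuple of test
functions `gᵢ` (`IsWeilTest`, `tsupport gᵢ ⊆ [-a, a]`) spans a subspace on which the real part of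
Weil's quadratic form `Q(g) = weilQuadratic g = W(g ⋆ g̃)` is negative definite: some non-zero
coefficient vector `c` has `0 ≤ Re Q(∑ cᵢ gᵢ)`.  This is the finiteness of the negative index of
the window form (Yoshida 1992; Bombieri 2000 §4; Connes–Consani–Moscovici 2025, Thm. 3.6:
discrete lower-bounded spectrum).

**Proof.** Unconditional, over the tree's PROVED sequential compact embedding
`ConnesConsaniMoscovici2025_thm_3_6_holds`.  Reduce to the window `max a 1 > 0` by restriction.
If every `N` admitted an `(N+1)`-tuple of window tests with `Re Q` negative definite on non-zero
combinations, then (Gram–Schmidt in `L²(ℝ)` plus a pigeonhole among `N + 1` orthonormal vectors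
against `N` earlier points) one builds inductively (`exists_seq_of_forall_finset_exists`) an
`L²`-normalised sequence of window tests `fₙ` with `Re Q(fₙ) < 0` and `∫ ‖fₙ - fₘ‖² ≥ 1/4` for
`m < n`; by Thm. 3.6 it has an `L²`-convergent subsequence — contradiction (Minkowski).

Mathlib + `Literature.NumberTheory.LFunctions.WeilSemilocalCompactnessProofs` only; no named fact
is used; no definitions.
-/

set_option linter.dupNamespace false

noncomputable section

open Complex MeasureTheory Filter Set
open scoped BigOperators Topology ComplexConjugate

namespace Summit.RiemannHypothesis.RiemannHypothesis.Theorems.RuelleBandCofiniteCriticalLine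

open Literature.NumberTheory.LFunctions

/-! ### Hilbert-space geometry: a pigeonhole among orthonormal vectors -/

/-- **Greedy / pigeonhole lemma.** If `e₀, …, e_m` are orthonormal and `p` is a family of fewer
than `m + 1` points, some `e_k` is at distance `≥ 1/2` from every `p j`: two distinct `e_k, e_l`
within `1/2` of the same point would be at distance `< 1`, whereas `‖e_k - e_l‖² = 2`. [folklore] -/
theorem stub_windowIndexFinite_greedy {E : Type*} [NormedAddCommGroup E] [InnerProductSpace ℂ E]
    {m : ℕ} {e : Fin (m + 1) → E} (he : Orthonormal ℂ e) {ι : Type*} [Fintype ι]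
    (hι : Fintype.card ι < m + 1) (p : ι → E) :
    ∃ k, ∀ j, 1 / 2 ≤ ‖e k - p j‖ := by
  by_contra h
  push Not at h
  choose J hJ using h
  obtain ⟨k, l, hkl, hJkl⟩ := Fintype.exists_ne_map_eq_of_card_lt J (by simpa using hι)
  have h2 : ‖e k - e l‖ ^ 2 = 2 := by
    rw [@norm_sub_sq ℂ, he.1 k, he.1 l, he.2 hkl]
    norm_num
  have h1 : ‖e k - e l‖ < 1 :=
    calc ‖e k - e l‖ ≤ ‖e k - p (J k)‖ + ‖p (J k) - e l‖ := norm_sub_le_norm_sub_add_norm_sub _ _ _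
      _ < 1 / 2 + 1 / 2 := by
          gcongr
          · exact hJ k
          · rw [norm_sub_rev, hJkl]; exact hJ l
      _ = 1 := by norm_num
  nlinarith [norm_nonneg (e k - e l)]

/-! ### `L²` bookkeeping for functions `ℝ → ℂ` -/

/-- `‖toLp f‖ = √∫ ‖f‖²` for `f ∈ L²(ℝ)`. [folklore] -/
theorem stub_windowIndexFinite_norm_toLp {f : ℝ → ℂ} (hf : MemLp f 2 (volume : Measure ℝ)) :
    ‖hf.toLp f‖ = Real.sqrt (∫ t, ‖f t‖ ^ 2) := by
  rw [Lp.norm_toLp, eLpNorm_two_eq_ofReal_sqrt hf, ENNReal.toReal_ofReal (Real.sqrt_nonneg _)]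

/-- `‖toLp f - toLp h‖ = √∫ ‖f - h‖²` for `f, h ∈ L²(ℝ)`. [folklore] -/
theorem stub_windowIndexFinite_norm_toLp_sub {f h : ℝ → ℂ} (hf : MemLp f 2 (volume : Measure ℝ))
    (hh : MemLp h 2 (volume : Measure ℝ)) :
    ‖hf.toLp f - hh.toLp h‖ = Real.sqrt (∫ t, ‖f t - h t‖ ^ 2) := by
  rw [← MemLp.toLp_sub hf hh, stub_windowIndexFinite_norm_toLp (hf.sub hh)]
  rfl

/-- `toLp` is linear on finite combinations:
`∑ i ∈ s, cᵢ • toLp gᵢ = toLp (t ↦ ∑ i ∈ s, cᵢ gᵢ t)`. [folklore] -/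
theorem stub_windowIndexFinite_sum_smul_toLp {ι : Type*} [DecidableEq ι] (s : Finset ι)
    (g : ι → ℝ → ℂ) (c : ι → ℂ) (hg : ∀ i, MemLp (g i) 2 (volume : Measure ℝ))
    (hs : MemLp (fun t => ∑ i ∈ s, c i * g i t) 2 (volume : Measure ℝ)) :
    ∑ i ∈ s, c i • (hg i).toLp (g i) = hs.toLp (fun t => ∑ i ∈ s, c i * g i t) := by
  induction s using Finset.induction_on with
  | empty =>
    rw [Finset.sum_empty, eq_comm, Lp.eq_zero_iff_ae_eq_zero]
    exact (MemLp.coeFn_toLp hs).trans (Eventually.of_forall fun t => by simp)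
  | insert a s ha ih =>
    have hs' : MemLp (fun t => ∑ i ∈ s, c i * g i t) 2 (volume : Measure ℝ) :=
      memLp_finsetSum s fun i _ => (hg i).const_mul (c i)
    rw [Finset.sum_insert ha, ih hs', ← MemLp.toLp_const_smul, ← MemLp.toLp_add]
    exact MemLp.toLp_congr _ _ (Eventually.of_forall fun t => by simp [Finset.sum_insert ha])

/-! ### Finite combinations of window test functions -/

/-- A finite combination `t ↦ ∑ cᵢ gᵢ(t)` of test functions on the window `[-b, b]` is a test
function on the same window. [folklore] -/
theorem stub_windowIndexFinite_isWeilTest_sum {b : ℝ} {n : ℕ} {g : Fin n → ℝ → ℂ}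
    (hg : ∀ i, IsWeilTest (g i)) (hsupp : ∀ i, tsupport (g i) ⊆ Icc (-b) b) (c : Fin n → ℂ) :
    IsWeilTest (fun t => ∑ i, c i * g i t) ∧
      tsupport (fun t => ∑ i, c i * g i t) ⊆ Icc (-b) b := by
  have hsub : tsupport (fun t => ∑ i, c i * g i t) ⊆ Icc (-b) b := by
    refine closure_minimal (fun t ht => ?_) isClosed_Icc
    by_contra hmem
    refine ht (Finset.sum_eq_zero fun i _ => ?_)
    rw [image_eq_zero_of_notMem_tsupport (fun h => hmem (hsupp i h)), mul_zero]
  exact ⟨⟨ContDiff.sum fun i _ => contDiff_const.mul (hg i).1,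
    IsCompact.of_isClosed_subset isCompact_Icc (isClosed_tsupport _) hsub⟩, hsub⟩

/-! ### The inductive step: a new unit vector far from finitely many old ones -/

/-- **Step.** Let `g₀, …, g_m` be test functions on `[-b, b]` such that `Re Q` is negative on
every non-zero combination, and let `p` be fewer than `m + 1` functions in `L²`.  Then some
combination `y = ∑ cᵢ gᵢ` is a window test with `∫ ‖y‖² = 1`, `Re Q(y) < 0` and
`∫ ‖y - p j‖² ≥ 1/4` for all `j` (the `L²`-classes of the `gᵢ` are linearly independent because
`Q(0) = 0`; Gram–Schmidt them and apply the pigeonhole lemma). [folklore] -/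
theorem stub_windowIndexFinite_step {b : ℝ} {m : ℕ} {g : Fin (m + 1) → ℝ → ℂ}
    (hg : ∀ i, IsWeilTest (g i)) (hsupp : ∀ i, tsupport (g i) ⊆ Icc (-b) b)
    (hneg : ∀ c : Fin (m + 1) → ℂ, c ≠ 0 → (weilQuadratic (fun t => ∑ i, c i * g i t)).re < 0)
    {ι : Type*} [Fintype ι] (hι : Fintype.card ι < m + 1) {p : ι → ℝ → ℂ}
    (hp : ∀ j, MemLp (p j) 2 (volume : Measure ℝ)) :
    ∃ y : ℝ → ℂ, IsWeilTest y ∧ tsupport y ⊆ Icc (-b) b ∧ ∫ t, ‖y t‖ ^ 2 = (1 : ℝ) ∧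
      (weilQuadratic y).re < 0 ∧ ∀ j, 1 / 4 ≤ ∫ t, ‖y t - p j t‖ ^ 2 := by
  -- `L²` classes of the `gᵢ` and of their combinations
  have hgm : ∀ i, MemLp (g i) 2 (volume : Measure ℝ) := fun i =>
    (hg i).1.continuous.memLp_of_hasCompactSupport (hg i).2
  have hY : ∀ c : Fin (m + 1) → ℂ, IsWeilTest (fun t => ∑ i, c i * g i t) ∧
      tsupport (fun t => ∑ i, c i * g i t) ⊆ Icc (-b) b := fun c =>
    stub_windowIndexFinite_isWeilTest_sum hg hsupp c
  have hYm : ∀ c : Fin (m + 1) → ℂ, MemLp (fun t => ∑ i, c i * g i t) 2 (volume : Measure ℝ) :=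
    fun c => (hY c).1.1.continuous.memLp_of_hasCompactSupport (hY c).1.2
  set v : Fin (m + 1) → Lp ℂ 2 (volume : Measure ℝ) := fun i => (hgm i).toLp (g i) with hv
  have hcomb : ∀ c : Fin (m + 1) → ℂ,
      ∑ i, c i • v i = (hYm c).toLp (fun t => ∑ i, c i * g i t) := fun c =>
    stub_windowIndexFinite_sum_smul_toLp Finset.univ g c hgm (hYm c)
  have hnorm : ∀ c : Fin (m + 1) → ℂ, ‖∑ i, c i • v i‖ ^ 2 = ∫ t, ‖∑ i, c i * g i t‖ ^ 2 := by
    intro c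
    rw [hcomb, stub_windowIndexFinite_norm_toLp,
      Real.sq_sqrt (integral_nonneg fun t => by positivity)]
  -- linear independence in `L²` (from `Q(0) = 0` and the negativity hypothesis)
  have hli : LinearIndependent ℂ v := by
    refine Fintype.linearIndependent_iff.2 fun c hc => ?_
    by_contra hc0
    have hc0' : c ≠ 0 := by
      rintro rfl
      exact hc0 fun i => rfl
    have hint : ∫ t, ‖∑ i, c i * g i t‖ ^ 2 = 0 := by
      rw [← hnorm, hc, norm_zero, zero_pow two_ne_zero]
    have hzero : (fun t => ∑ i, c i * g i t) = 0 :=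
      (hY c).1.eq_zero_of_integral_norm_sq_eq_zero hint
    have hlt := hneg c hc0'
    rw [hzero, weilQuadratic_zero, Complex.zero_re] at hlt
    exact lt_irrefl _ hlt
  -- Gram–Schmidt
  have he_on : Orthonormal ℂ (InnerProductSpace.gramSchmidtNormed ℂ v) :=
    InnerProductSpace.gramSchmidtNormed_orthonormal hli
  have he_span : ∀ k, ∃ c : Fin (m + 1) → ℂ,
      ∑ i, c i • v i = InnerProductSpace.gramSchmidtNormed ℂ v k := by
    intro k
    have hk : InnerProductSpace.gramSchmidtNormed ℂ v k ∈
        Submodule.span ℂ (Set.range (InnerProductSpace.gramSchmidtNormed ℂ v)) :=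
      Submodule.subset_span ⟨k, rfl⟩
    rw [InnerProductSpace.span_gramSchmidtNormed_range, InnerProductSpace.span_gramSchmidt] at hk
    exact (Submodule.mem_span_range_iff_exists_fun ℂ).1 hk
  -- pigeonhole
  obtain ⟨k, hk⟩ := stub_windowIndexFinite_greedy he_on hι fun j => (hp j).toLp (p j)
  obtain ⟨c, hc⟩ := he_span k
  refine ⟨fun t => ∑ i, c i * g i t, (hY c).1, (hY c).2, ?_, ?_, fun j => ?_⟩
  · rw [← hnorm, hc, he_on.1 k, one_pow]
  · refine hneg c ?_
    rintro rfl
    have h1 := he_on.1 k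
    rw [← hc] at h1
    simp at h1
  · have h := hk j
    rw [← hc, hcomb, stub_windowIndexFinite_norm_toLp_sub,
      Real.le_sqrt' (by norm_num : (0 : ℝ) < 1 / 2)] at h
    norm_num at h
    exact h

/-! ### The window `b > 0`: contradiction with the compact embedding -/

/-- **Finite index on a window `b > 0`.**  Otherwise the step lemma and
`exists_seq_of_forall_finset_exists` produce an `L²`-normalised, `1/4`-separated (in `∫ ‖·‖²`)
sequence of window tests with `Re Q < 0`, which by the PROVED compact embedding
`ConnesConsaniMoscovici2025_thm_3_6_holds` has an `L²`-convergent subsequence: two consecutive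
terms of it are eventually both within `1/64` of the limit, hence within `1/16` of each other
(Minkowski, `sqrt_integral_norm_sq_sub_le`) — absurd.
[cite: ConnesConsaniMoscovici2025, Thm. 3.6 and Prop. 3.5] -/
theorem stub_windowIndexFinite_of_pos {b : ℝ} (hb : 0 < b) :
    ∃ N : ℕ, ∀ g : Fin (N + 1) → ℝ → ℂ, (∀ i, IsWeilTest (g i)) →
      (∀ i, tsupport (g i) ⊆ Set.Icc (-b) b) →
      ∃ c : Fin (N + 1) → ℂ, c ≠ 0 ∧ 0 ≤ (weilQuadratic (fun t => ∑ i, c i * g i t)).re := by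
  by_contra H
  push Not at H
  -- the separated sequence
  obtain ⟨f, hf, hsep⟩ := exists_seq_of_forall_finset_exists
    (fun y : ℝ → ℂ => IsWeilTest y ∧ tsupport y ⊆ Icc (-b) b ∧ ∫ t, ‖y t‖ ^ 2 = (1 : ℝ) ∧
      (weilQuadratic y).re < 0)
    (fun x y : ℝ → ℂ => 1 / 4 ≤ ∫ t, ‖y t - x t‖ ^ 2) (fun s hs => by
      obtain ⟨g, hg, hsupp, hneg⟩ := H s.card
      have hι : Fintype.card s < s.card + 1 := by
        rw [Fintype.card_coe]; exact Nat.lt_succ_self _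
      obtain ⟨y, hy, hysupp, hy1, hyQ, hyfar⟩ := stub_windowIndexFinite_step hg hsupp hneg hι
        (p := fun x : s => (x : ℝ → ℂ))
        (fun x => (hs x x.2).1.1.continuous.memLp_of_hasCompactSupport (hs x x.2).1.2)
      exact ⟨y, ⟨hy, hysupp, hy1, hyQ⟩, fun x hx => hyfar ⟨x, hx⟩⟩)
  -- compactness
  have hbdd : BddAbove (Set.range fun n => (weilQuadratic (f n)).re) :=
    ⟨0, by rintro _ ⟨n, rfl⟩; exact (hf n).2.2.2.le⟩
  obtain ⟨u, hu, φ, hφ, hconv⟩ := ConnesConsaniMoscovici2025_thm_3_6_holds b hb f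
    (fun n => ⟨(hf n).1, (hf n).2.1, (hf n).2.2.1⟩) hbdd
  have hfm : ∀ n, MemLp (f n) 2 (volume : Measure ℝ) := fun n =>
    (hf n).1.1.continuous.memLp_of_hasCompactSupport (hf n).1.2
  have hev : ∀ᶠ n in atTop, ∫ t, ‖f (φ n) t - u t‖ ^ 2 < 1 / 64 :=
    hconv (Iio_mem_nhds (by norm_num))
  obtain ⟨n₀, hn₀⟩ := eventually_atTop.1 hev
  have hsmall : ∀ n, n₀ ≤ n → Real.sqrt (∫ t, ‖(f (φ n) - u) t‖ ^ 2) < 1 / 8 := fun n hn => by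
    rw [Real.sqrt_lt' (by norm_num)]
    have := hn₀ n hn
    simp only [Pi.sub_apply]
    linarith
  have hmink := sqrt_integral_norm_sq_sub_le ((hfm (φ (n₀ + 1))).sub hu) ((hfm (φ n₀)).sub hu)
  simp only [Pi.sub_apply, sub_sub_sub_cancel_right] at hmink
  have hlt : Real.sqrt (∫ t, ‖f (φ (n₀ + 1)) t - f (φ n₀) t‖ ^ 2) < 1 / 4 := by
    have h1 := hsmall (n₀ + 1) (Nat.le_succ _)
    have h2 := hsmall n₀ le_rfl
    simp only [Pi.sub_apply] at h1 h2
    linarith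
  rw [Real.sqrt_lt' (by norm_num)] at hlt
  have hge := hsep (φ n₀) (φ (n₀ + 1)) (hφ (Nat.lt_succ_self n₀))
  linarith

/-! ### The stub -/

/-- **Stub `stub_windowIndexFinite` — every window has finite index** (Yoshida 1992; Bombieri
2000 §4 Lemma 3; Connes–Consani–Moscovici 2025 Thm. 3.6).  For every `a : ℝ` there is `N` such
that every `(N+1)`-tuple of test functions supported in `[-a, a]` admits a non-zero coefficient
vector `c` with `0 ≤ Re Q(∑ cᵢ gᵢ)`.  Proof: the window `max a 1 > 0` has finite index
(`stub_windowIndexFinite_of_pos`), and an index bound restricts to the smaller window `a`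
(for `a ≤ 0` this covers the degenerate windows as well).
[cite: ConnesConsaniMoscovici2025, Thm. 3.6] -/
theorem stub_windowIndexFinite :
    ∀ a : ℝ, ∃ N : ℕ, ∀ g : Fin (N + 1) → ℝ → ℂ, (∀ i, IsWeilTest (g i)) →
        (∀ i, tsupport (g i) ⊆ Set.Icc (-a) a) →
        ∃ c : Fin (N + 1) → ℂ, c ≠ 0 ∧ 0 ≤ (weilQuadratic (fun t => ∑ i, c i * g i t)).re := by
  intro a
  obtain ⟨N, hN⟩ := stub_windowIndexFinite_of_pos (lt_of_lt_of_le one_pos (le_max_right a 1))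
  exact ⟨N, fun g hg hsupp => hN g hg fun i => (hsupp i).trans
    (Set.Icc_subset_Icc (neg_le_neg (le_max_left a 1)) (le_max_left a 1))⟩

end Summit.RiemannHypothesis.RiemannHypothesis.Theorems.RuelleBandCofiniteCriticalLine

end
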